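import Mathlib
import Literature.Analysis.Convex.KrasnoselskijIteration
import Literature.Analysis.Convex.ProximalPointAlgorithm
import Literature.Analysis.Convex.IterationStability
import Literature.Analysis.Convex.DouglasRachfordSplitting
import HarnessLib

/-!
# Anderson acceleration: the affine-case residual bound (Toth–Kelley 2015) and global convergence
# of the SAFEGUARDED scheme on (quasi-)nonexpansive maps (Zhang–O'Donoghue–Boyd 2020)

Topic `Literature/Analysis/Convex` (uses the tree's averaged map `KrasnoselskijIteration.averagedMap`
and convex-combination identity `norm_sq_convex_combination` [Berinde2007, Thm 3.2], and the
quasi-Fejér assembly `ProximalPointAlgorithm.exists_tendsto_of_quasiFejer` [EcksteinBertsekas1992,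
Thm 3 (proof)] / [Berinde2007, Lemma 1.7]). Namespace `Literature.Analysis.Convex.AndersonAcceleration`.
Everything PROVED; no named facts, no `sorry`.

Sources.
* [ZOB20] J. Zhang, B. O'Donoghue, S. Boyd, *Globally convergent type-I Anderson acceleration for
  nonsmooth fixed-point iterations*, SIAM J. Optim. 30 (2020) 3170–3197 = arXiv:1808.03971
  [ZhangOdonoghueBoyd2020] (held, `lit` key `paper:arxiv-1808.03971`; read §1 (problem (1): `x = f(x)`,
  `f` non-expansive in `ℓ₂`, solution set `X ≠ ∅`; KM step `x^{k+1} = (1−α)x^k + αf(x^k)`), §2.1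
  Algorithm 1 (AA prototype: `x^{k+1} = Σ_j α_j^k f(x^{k−m_k+j})`, `Σ_j α_j^k = 1`), §2.2 (residual
  `g(x) = x − f(x)`, AA-II least squares (5)), §3.3 Algorithm 3 (AA-I-S-m: lines 12–14, the
  safe-guard "If `‖g_k‖ ≤ D Ū (n_AA+1)^{−(1+ε)}`: `x^{k+1} = x̃^{k+1} = x^k − H_k g_k`, `n_AA += 1`;
  else `x^{k+1} = f_α(x^k)`"), Corollary 5 (`‖H_k‖₂ ≤ C` uniformly), §4 (the three-step proof) and
  **Theorem 6**: "Suppose that `{x^k}` is generated by Algorithm 3, then `lim_k x^k = x⋆`, where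
  `x⋆ = f(x⋆)` is a solution to (1)." — §6 **Corollary 8** (the same if `f` is only
  quasi-nonexpansive) and §5.1.3 **Theorem 7** (the same, with `α = 1` allowed, if `f` is
  `γ`-contractive in an ARBITRARY norm; proof in the appendix).
* [TK15] A. Toth, C. T. Kelley, *Convergence analysis for Anderson acceleration*, SIAM J. Numer.
  Anal. 53 (2015) 805–819 [TothKelley2015] (NOT held — paywalled, acquisition acq-13310; its
  **Theorem 2.1** (linear case) is restated in the held secondaries [DeSterckHeKrzysik2021] = H. De
  Sterck, Y. He, O. Krzysik, arXiv:2109.14181, §1.2 p. 4: "[Toth–Kelley] shows that the AA(`m`)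
  residuals satisfy `‖r_{k+1}‖ ≤ ‖M‖ ‖r_k‖`, which implies `‖r_{k+1}‖ < ‖r_k‖` when `‖M‖ < 1`"
  (used as "Theorem 2.1 in [toth2015]" in the proof of their Prop. 11, p. 9), and [DeSterckHe2021]
  = H. De Sterck, Y. He, arXiv:2109.14176, §1 p. 5: "for the linear case where `q(x) = Mx + b`, if
  `‖M‖ = c < 1`, `x_k` converges at least r-linearly with r-linear convergence factor not worse than
  `c`, for any initial guess").

WHAT IS TYPED.

§1 `resid f x = x − f x` (the residual `g` of [ZOB20, §2.2]; [TK15]'s `F(u) = G(u) − u` is `−g(u)`,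
all statements below are about norms), `kmStep_sub_eq` (`f_α(x) − x = −α g(x)`), and the ANDERSON
MIXING STEP `aaStep G u a = Σ_j a_j • G(u_j)` over a memory `u : Fin (m+1) → E` with weights
`Σ_j a_j = 1` [ZOB20, Algorithm 1, line 5] (`aaStep_single`: the trivial weight gives the Picard step).

§2 [TK15, Thm 2.1] THE AFFINE CASE, any real normed space, `G u = M u + c`, `M` continuous linear:
`resid_aaStep_affine` (`g(x^{k+1}) = M(Σ_j a_j g(u_j))`), **`norm_resid_aaStep_le`** (if the weights
do at least as well as the trivial weight `e_last` in the residual least-squares problem — in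
particular for the AA-II minimiser, `resOptimal_of_isMinOn` — then `‖g(x^{k+1})‖ ≤ ‖M‖·‖g(x^k)‖`);
along an Anderson sequence (`IsAndersonSeq`): `norm_resid_succ_le`, `norm_resid_le_pow`
(`‖g(x^k)‖ ≤ ‖M‖^k ‖g(x^0)‖`), and for `‖M‖ < 1` on a complete space: `norm_sub_fixedPoint_le`
(`‖x − x⋆‖ ≤ ‖g(x)‖/(1 − ‖M‖)`), **`tendsto_andersonSeq_affine`** (`x^k → x⋆`, the unique fixed
point, with the r-linear bound `norm_sub_fixedPoint_le_pow`).

§3 [ZOB20, Thm 6 / Cor 8] THE SAFEGUARDED SCHEME, ABSTRACT FORM. What the proof of Theorem 6 uses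
of Algorithm 3 is exactly: at every iteration EITHER the KM step `x^{k+1} = f_α(x^k)` is taken, OR
("accepted AA step", index set `K_AA`) the safeguard test `‖g_k‖ ≤ b_{n_k}` passed — `n_k` = number
of AA steps accepted before `k`, `(b_i)` a nonnegative SUMMABLE envelope (printed:
`b_i = D Ū (i+1)^{−(1+ε)}`) — and the step obeys `‖x^{k+1} − x^k‖ ≤ C‖g_k‖` (printed: `x^{k+1} =
x^k − H_k g_k` with `‖H_k‖₂ ≤ C`, Corollary 5). This is the predicate `IsSafeguardedAA f α C b S x`
(`S` = the set of accepted AA steps, `aaCount S k = n_k`). Then, for `f` quasi-nonexpansive with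
respect to its (nonempty) fixed-point set and continuous, on a proper (e.g. finite-dimensional) real
inner product space, `0 < α < 1`:
* `envelope` (`B_k = b_{n_k}` at accepted steps, else `0`), `sum_envelope_eq` (`Σ_{k<K} B_k =
  Σ_{i<n_K} b_i`, the re-indexing of `Σ_{k_i ∈ K_AA}` by `i`), `summable_envelope`;
* Step 1: `norm_succ_sub_le` (quasi-Fejér: `‖x^{k+1} − y‖ ≤ ‖x^k − y‖ + ε_k`), `norm_sub_le_bound`
  (bounded), `norm_succ_sub_sq_le` ((12)–(13)), `summable_kmDecrease` ((14)),
  **`tendsto_norm_resid`** (`‖g_k‖ → 0`, (15));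
* Steps 2–3: **`exists_tendsto_of_isSafeguardedAA`** — THEOREM 6 / COROLLARY 8: `x^k → x⋆` with
  `f x⋆ = x⋆`; `exists_tendsto_of_isSafeguardedAA_of_nonexpansive` (the printed hypothesis: `f`
  non-expansive with a fixed point); `summable_printedEnvelope` + `exists_tendsto_zob` (the printed
  envelope `D Ū (i+1)^{−(1+ε)}`); `summable_geometricEnvelope` + `exists_tendsto_zob_geometric` (the
  geometric envelope `U c^i` produced by a relative-decrease acceptance test with factor `c < 1`).

§4 [ZOB20, Thm 7] contractive maps in an ARBITRARY norm: `norm_succ_sub_le_contractive`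
(`‖x^{k+1} − y‖ ≤ (1 − α(1−γ))‖x^k − y‖ + (1/(1−γ) + C) B_k`), **`tendsto_of_isSafeguardedAA_of_contractive`**
(any real normed space, `f` `γ`-contractive towards its fixed point `y`, `0 < α ≤ 1`: `x^k → y`, via
the tree's [Berinde2007, Lemma 1.6 (i)] `IterationStability.tendsto_zero_of_succ_le_mul_add`) and
`exists_tendsto_of_isSafeguardedAA_of_contractive` (globally `γ`-contractive `f`, complete space: the
fixed point exists and attracts the scheme).

§5 [ZOB20, §5.1.2] THE PRINTED APPLICATION TO DOUGLAS–RACHFORD SPLITTING (the SCS use-case): for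
maximal monotone `A`, `B` with resolvent maps `ja = J_{λA}`, `jb = J_{λB}` (tree
`DouglasRachford.drStep ja jb`, nonexpansive by [EcksteinBertsekas1992, Cor 4.1]
`DouglasRachford.norm_drStep_sub_le`, fixed points ↔ zeros of `A + B` by Thm 5), the safeguarded
scheme run on `f = drStep ja jb` converges to a fixed point `z⋆` and the shadow sequence
`x^k = J_{λB}(z^k)` converges to the zero `J_{λB}(z⋆)` of `A + B`:
**`exists_tendsto_of_isSafeguardedAA_drStep`** ("whenever `z^k` converges to a fixed-point of (DRS)
(not necessarily following the DRS iteration), `x^k = R_B(z^k)` converges to a solution").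

Deviations (inessential, recorded): (i) Step 3 of [ZOB20, §4] is run through the tree's quasi-Fejér
lemma (a cluster point that is a fixed point attracts the whole sequence, [Berinde2007, Lemma 1.7 (ii)])
instead of the printed two-cluster-point computation; (ii) continuity of `f` is an explicit hypothesis
(automatic for non-expansive `f`, which is how [ZOB20] uses it: "`g(x) = x − f(x)` is (Lipschitz)
continuous"); (iii) the linear algebra of AA-I (`H_k`, Powell regularisation, re-starts, Lemmas 2–3,
Corollaries 4–5: the BOUND `‖H_k‖₂ ≤ C`) is not typed — it enters only through the step bound
`‖x^{k+1} − x^k‖ ≤ C‖g_k‖`, so the theorem covers every acceleration device run under the same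
safeguard (AA-I, AA-II, any quasi-Newton candidate); (iv) [TK15]'s local r-linear theorem for
NONLINEAR contractive `C¹` maps (their §2.2) and the asymptotic-rate literature are not typed; (v) no
rate is claimed for §3–§4 — none is printed ([ZOB20, §1]: "our analysis does not provide a rate of
convergence"). Floating-point effects are not modelled.
-/

namespace Literature.Analysis.Convex.AndersonAcceleration

open Filter Topology Finset
open scoped RealInnerProductSpace
open Literature.Analysis.Convex.KrasnoselskijIteration (averagedMap norm_sq_convex_combination)
open Literature.Analysis.Convex.ProximalPointAlgorithm (exists_tendsto_of_quasiFejer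
  norm_sub_le_of_quasiFejer le_add_sum_of_le_add)

/-! ## §1 The residual and the Anderson mixing step -/

section Basic

variable {E : Type*} [NormedAddCommGroup E]

/-- The residual `g(x) = x − f(x)` of the fixed-point map `f` ([TK15] write `F(u) = G(u) − u = −g(u)`;
only norms of residuals enter the statements). [cite: ZhangOdonoghueBoyd2020, §2.2 (g(x) = x − f(x))] -/
def resid (f : E → E) (x : E) : E := x - f x

/-- Unfolding `g(x) = x − f(x)`. [cite: ZhangOdonoghueBoyd2020, §2.2] -/
theorem resid_apply (f : E → E) (x : E) : resid f x = x - f x := rfl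

/-- `g(x) = 0 ⇔ x = f(x)`. [cite: ZhangOdonoghueBoyd2020, §1 (1), §2.2] -/
theorem resid_eq_zero_iff {f : E → E} {x : E} : resid f x = 0 ↔ f x = x := by
  rw [resid, sub_eq_zero, eq_comm]

/-- The fixed-point set `X = {x | x = f(x)}` is the zero set of the residual.
[cite: ZhangOdonoghueBoyd2020, §1 (X = {x⋆ | x⋆ = f(x⋆)})] -/
theorem mem_fixedPoints_iff_resid {f : E → E} {x : E} :
    x ∈ Function.fixedPoints f ↔ resid f x = 0 := by
  rw [Function.mem_fixedPoints, Function.IsFixedPt, resid_eq_zero_iff]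

/-- If `f` is continuous then so is its residual ("`g(x) = x − f(x)` is (Lipschitz) continuous" for
non-expansive `f`). [cite: ZhangOdonoghueBoyd2020, §4 Step 3] -/
theorem continuous_resid {f : E → E} (hf : Continuous f) : Continuous (resid f) :=
  continuous_id.sub hf

variable [NormedSpace ℝ E]

/-- The averaged (KM) step `f_α(x) = (1 − α)x + αf(x)` moves by `−α g(x)`.
[cite: ZhangOdonoghueBoyd2020, §1 (x^{k+1} = (1 − α)x^k + α f(x^k))] -/
theorem kmStep_sub_eq (f : E → E) (α : ℝ) (x : E) :
    ((1 - α) • x + α • f x) - x = -(α • resid f x) := by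
  simp only [resid, smul_sub]
  module

/-- **The Anderson mixing step** `x^{k+1} = Σ_{j=0}^{m_k} α_j^k f(x^{k−m_k+j})` over a memory
`u = (x^{k−m_k}, …, x^k)` of `m + 1` points with weights `a`, `Σ_j a_j = 1` (both AA-I and AA-II are
of this form; they differ in the choice of `a`). [cite: ZhangOdonoghueBoyd2020, §2.1 Algorithm 1 (line 5)] -/
def aaStep (G : E → E) {m : ℕ} (u : Fin (m + 1) → E) (a : Fin (m + 1) → ℝ) : E :=
  ∑ j, a j • G (u j)

/-- Unfolding the mixing step. [cite: ZhangOdonoghueBoyd2020, §2.1 Algorithm 1 (line 5)] -/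
theorem aaStep_def (G : E → E) {m : ℕ} (u : Fin (m + 1) → E) (a : Fin (m + 1) → ℝ) :
    aaStep G u a = ∑ j, a j • G (u j) := rfl

/-- With the trivial weight (all mass on the newest point) the mixing step is the plain fixed-point
step `f(x^k)` (AA with memory `m_k = 0` is the Picard iteration).
[cite: ZhangOdonoghueBoyd2020, §2.1 (KM/Picard as the special case of Algorithm 1)] -/
theorem aaStep_single (G : E → E) {m : ℕ} (u : Fin (m + 1) → E) :
    aaStep G u (fun j => if j = Fin.last m then 1 else 0) = G (u (Fin.last m)) := by
  simp [aaStep, ite_smul, Finset.sum_ite_eq']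

end Basic

/-! ## §2 The affine case: Anderson mixing is no worse than the Picard step [TK15, Thm 2.1] -/

section Affine

variable {E : Type*} [NormedAddCommGroup E] [NormedSpace ℝ E]
variable (M : E →L[ℝ] E) (c : E)

/-- The affine fixed-point map `G(u) = M u + c` of [TK15, §2.1] (`q(x) = Mx + b` in
[DeSterckHe2021]). [cite: TothKelley2015, Thm 2.1 (linear case G(u) = Mu + b)]
[cite: DeSterckHe2021, §1 p. 5 (q(x) = Mx + b)] -/
def affineMap (u : E) : E := M u + c

/-- Unfolding `G(u) = Mu + c`. [cite: TothKelley2015, Thm 2.1] -/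
theorem affineMap_apply (u : E) : affineMap M c u = M u + c := rfl

/-- For an affine map the residual is affine with linear part `1 − M`:
`g(u) − g(v) = (1 − M)(u − v)`. [cite: TothKelley2015, Thm 2.1 (proof)] -/
theorem resid_affine_sub (u v : E) :
    resid (affineMap M c) u - resid (affineMap M c) v = (u - v) - M (u - v) := by
  simp only [resid, affineMap, map_sub]
  abel

/-- The residual of a weighted average with `Σ a_j = 1` is the weighted average of the residuals
(affine case). [cite: TothKelley2015, Thm 2.1 (proof)] -/
theorem resid_affine_sum {m : ℕ} (u : Fin (m + 1) → E) (a : Fin (m + 1) → ℝ)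
    (ha : ∑ j, a j = 1) :
    resid (affineMap M c) (∑ j, a j • u j) = ∑ j, a j • resid (affineMap M c) (u j) := by
  have hc : ∑ j, a j • c = c := by rw [← Finset.sum_smul, ha, one_smul]
  simp only [resid, affineMap, map_sum, map_smul, smul_sub, smul_add, Finset.sum_sub_distrib,
    Finset.sum_add_distrib, hc]

/-- **The key identity of the affine case**: with `Σ_j a_j = 1`,
`g(x^{k+1}) = M (Σ_j a_j g(u_j))` for `x^{k+1} = Σ_j a_j G(u_j)`.
[cite: TothKelley2015, Thm 2.1 (proof)] [cite: DeSterckHeKrzysik2021, §1.2 p. 4] -/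
theorem resid_aaStep_affine {m : ℕ} (u : Fin (m + 1) → E) (a : Fin (m + 1) → ℝ)
    (ha : ∑ j, a j = 1) :
    resid (affineMap M c) (aaStep (affineMap M c) u a) =
      M (∑ j, a j • resid (affineMap M c) (u j)) := by
  have h1 : aaStep (affineMap M c) u a = M (∑ j, a j • u j) + c := by
    simp only [aaStep, affineMap, smul_add, Finset.sum_add_distrib, map_sum, map_smul]
    rw [← Finset.sum_smul, ha, one_smul]
  rw [h1, ← resid_affine_sum M c u a ha]
  simp only [resid, affineMap, map_add, map_sub]
  abel

/-- The weights `a` (with `Σ a_j = 1`) are **residual-optimal** for the memory `u` if they do at least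
as well as the trivial weight `e_last` in the least-squares problem (5):
`‖Σ_j a_j g(u_j)‖ ≤ ‖g(u_last)‖`. This is all that the proof of [TK15, Thm 2.1] uses of the
minimisation. [cite: ZhangOdonoghueBoyd2020, §2.2 (5)] [cite: TothKelley2015, Thm 2.1 (proof)] -/
def ResOptimal (G : E → E) {m : ℕ} (u : Fin (m + 1) → E) (a : Fin (m + 1) → ℝ) : Prop :=
  ∑ j, a j = 1 ∧ ‖∑ j, a j • resid G (u j)‖ ≤ ‖resid G (u (Fin.last m))‖

/-- The AA-II choice — `a` MINIMISES `‖Σ_j a_j g(u_j)‖` subject to `Σ_j a_j = 1`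
[ZOB20, (5)] — is residual-optimal (compare with the feasible weight `e_last`).
[cite: ZhangOdonoghueBoyd2020, §2.2 (5)] -/
theorem resOptimal_of_isMinOn (G : E → E) {m : ℕ} (u : Fin (m + 1) → E) (a : Fin (m + 1) → ℝ)
    (ha : ∑ j, a j = 1)
    (hmin : IsMinOn (fun a' : Fin (m + 1) → ℝ => ‖∑ j, a' j • resid G (u j)‖)
      {a' | ∑ j, a' j = 1} a) : ResOptimal G u a := by
  refine ⟨ha, ?_⟩
  have h := hmin (a := fun j => if j = Fin.last m then (1 : ℝ) else 0) (by simp)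
  simpa [ite_smul, Finset.sum_ite_eq'] using h

/-- **[TK15, Theorem 2.1], one step.** For the affine map `G(u) = Mu + c` and residual-optimal weights,
the Anderson step does at least as well as the Picard step on the residual:
`‖g(x^{k+1})‖ ≤ ‖M‖ · ‖g(x^k)‖` (`x^k = u_last` the newest point of the memory).
[cite: TothKelley2015, Thm 2.1] [cite: DeSterckHeKrzysik2021, §1.2 p. 4 (‖r_{k+1}‖ ≤ ‖M‖ ‖r_k‖)] -/
theorem norm_resid_aaStep_le {m : ℕ} (u : Fin (m + 1) → E) (a : Fin (m + 1) → ℝ)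
    (hopt : ResOptimal (affineMap M c) u a) :
    ‖resid (affineMap M c) (aaStep (affineMap M c) u a)‖ ≤
      ‖M‖ * ‖resid (affineMap M c) (u (Fin.last m))‖ := by
  rw [resid_aaStep_affine M c u a hopt.1]
  exact (M.le_opNorm _).trans (mul_le_mul_of_nonneg_left hopt.2 (norm_nonneg _))

/-- **An Anderson sequence** for `G`: each iterate is an Anderson mixing step over SOME memory whose
newest point is the current iterate, with residual-optimal weights (window sizes `m_k`, the older
memory points and the weights are otherwise arbitrary — AA(`m`) with the least-squares weights of (5)
is the printed instance, `resOptimal_of_isMinOn`).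
[cite: ZhangOdonoghueBoyd2020, §2.1 Algorithm 1, §2.2 (5)] [cite: TothKelley2015, §1 (Anderson(m))] -/
def IsAndersonSeq (G : E → E) (x : ℕ → E) : Prop :=
  ∀ k, ∃ (m : ℕ) (u : Fin (m + 1) → E) (a : Fin (m + 1) → ℝ),
    u (Fin.last m) = x k ∧ ResOptimal G u a ∧ x (k + 1) = aaStep G u a

/-- The Picard iteration `x^{k+1} = G(x^k)` is an Anderson sequence (memory `m_k = 0`).
[cite: ZhangOdonoghueBoyd2020, §2.1] -/
theorem isAndersonSeq_picard (G : E → E) (x : ℕ → E) (hx : ∀ k, x (k + 1) = G (x k)) :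
    IsAndersonSeq G x := by
  intro k
  refine ⟨0, fun _ => x k, fun _ => 1, rfl, ⟨by simp, by simp⟩, ?_⟩
  simp [aaStep, hx k]

variable {M c}

/-- **[TK15, Theorem 2.1] along the iteration**: `‖g(x^{k+1})‖ ≤ ‖M‖ · ‖g(x^k)‖` for every `k`.
[cite: TothKelley2015, Thm 2.1] [cite: DeSterckHeKrzysik2021, §1.2 p. 4] -/
theorem norm_resid_succ_le {x : ℕ → E} (hx : IsAndersonSeq (affineMap M c) x) (k : ℕ) :
    ‖resid (affineMap M c) (x (k + 1))‖ ≤ ‖M‖ * ‖resid (affineMap M c) (x k)‖ := by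
  obtain ⟨m, u, a, hu, hopt, hstep⟩ := hx k
  rw [hstep, ← hu]
  exact norm_resid_aaStep_le M c u a hopt

/-- Consequently `‖g(x^k)‖ ≤ ‖M‖^k ‖g(x^0)‖`: for `‖M‖ = c < 1` the residuals converge to zero
q-linearly with q-factor `c`, and AA(`m`) "can never stagnate". [cite: TothKelley2015, Thm 2.1]
[cite: DeSterckHeKrzysik2021, §1.2 p. 4] -/
theorem norm_resid_le_pow {x : ℕ → E} (hx : IsAndersonSeq (affineMap M c) x) (k : ℕ) :
    ‖resid (affineMap M c) (x k)‖ ≤ ‖M‖ ^ k * ‖resid (affineMap M c) (x 0)‖ := by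
  induction k with
  | zero => simp
  | succ k ih =>
    calc ‖resid (affineMap M c) (x (k + 1))‖ ≤ ‖M‖ * ‖resid (affineMap M c) (x k)‖ :=
          norm_resid_succ_le hx k
      _ ≤ ‖M‖ * (‖M‖ ^ k * ‖resid (affineMap M c) (x 0)‖) :=
          mul_le_mul_of_nonneg_left ih (norm_nonneg _)
      _ = ‖M‖ ^ (k + 1) * ‖resid (affineMap M c) (x 0)‖ := by ring

/-- Distance to a fixed point is controlled by the residual when `‖M‖ < 1`:
`‖x − x⋆‖ ≤ ‖g(x)‖ / (1 − ‖M‖)` (since `g(x) = g(x) − g(x⋆) = (1 − M)(x − x⋆)`).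
[cite: TothKelley2015, Thm 2.1 (convergence of the iterates)] [cite: DeSterckHe2021, §1 p. 5] -/
theorem norm_sub_fixedPoint_le {xs x : E} (hxs : affineMap M c xs = xs) (hM : ‖M‖ < 1) :
    ‖x - xs‖ ≤ ‖resid (affineMap M c) x‖ / (1 - ‖M‖) := by
  have hg : resid (affineMap M c) xs = 0 := resid_eq_zero_iff.2 hxs
  have h1 : resid (affineMap M c) x = (x - xs) - M (x - xs) := by
    have := resid_affine_sub M c x xs
    rwa [hg, sub_zero] at this
  have h2 : ‖x - xs‖ ≤ ‖M‖ * ‖x - xs‖ + ‖resid (affineMap M c) x‖ := by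
    calc ‖x - xs‖ ≤ ‖M (x - xs)‖ + ‖(x - xs) - M (x - xs)‖ := norm_le_insert' _ _
      _ ≤ ‖M‖ * ‖x - xs‖ + ‖resid (affineMap M c) x‖ := by
          rw [h1]; exact add_le_add (M.le_opNorm _) le_rfl
  rw [le_div_iff₀ (by linarith)]
  nlinarith [norm_nonneg (x - xs)]

/-- When `‖M‖ < 1` the affine map is a contraction, so (on a complete space) it has a unique fixed point
`x⋆ = (1 − M)⁻¹ c`. [cite: TothKelley2015, Thm 2.1 (u* = (I − M)⁻¹ b)] [cite: DeSterckHe2021, §1 p. 5] -/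
theorem exists_unique_fixedPoint_affine [CompleteSpace E] (hM : ‖M‖ < 1) :
    ∃! xs : E, affineMap M c xs = xs := by
  have hK : ContractingWith ‖M‖₊ (affineMap M c) := by
    refine ⟨by exact_mod_cast hM, LipschitzWith.of_dist_le_mul fun u v => ?_⟩
    rw [dist_eq_norm, dist_eq_norm, coe_nnnorm]
    calc ‖affineMap M c u - affineMap M c v‖ = ‖M (u - v)‖ := by
            simp only [affineMap, map_sub]; congr 1; abel
      _ ≤ ‖M‖ * ‖u - v‖ := M.le_opNorm _
  refine ⟨ContractingWith.fixedPoint (affineMap M c) hK, hK.fixedPoint_isFixedPt, fun y hy => ?_⟩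
  exact (hK.fixedPoint_unique hy)

/-- **[TK15, Theorem 2.1] (convergence of AA(m) in the linear case).** On a complete real normed space,
if `‖M‖ < 1` then every Anderson sequence for `G(u) = Mu + c` converges to the fixed point `x⋆`, with
the r-linear bound `‖x^k − x⋆‖ ≤ ‖M‖^k ‖g(x^0)‖ / (1 − ‖M‖)` — "at least r-linearly with r-linear
convergence factor not worse than `c = ‖M‖`, for any initial guess".
[cite: TothKelley2015, Thm 2.1] [cite: DeSterckHe2021, §1 p. 5] -/
theorem norm_sub_fixedPoint_le_pow {x : ℕ → E} (hx : IsAndersonSeq (affineMap M c) x) {xs : E}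
    (hxs : affineMap M c xs = xs) (hM : ‖M‖ < 1) (k : ℕ) :
    ‖x k - xs‖ ≤ ‖M‖ ^ k * ‖resid (affineMap M c) (x 0)‖ / (1 - ‖M‖) :=
  (norm_sub_fixedPoint_le hxs hM).trans
    (div_le_div_of_nonneg_right (norm_resid_le_pow hx k) (by linarith))

/-- **[TK15, Theorem 2.1]**, limit form: `x^k → x⋆`, the unique fixed point of `G(u) = Mu + c`,
`‖M‖ < 1`, complete space. [cite: TothKelley2015, Thm 2.1] [cite: DeSterckHe2021, §1 p. 5] -/
theorem tendsto_andersonSeq_affine [CompleteSpace E] {x : ℕ → E}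
    (hx : IsAndersonSeq (affineMap M c) x) (hM : ‖M‖ < 1) :
    ∃ xs : E, affineMap M c xs = xs ∧ Tendsto x atTop (𝓝 xs) := by
  obtain ⟨xs, hxs, -⟩ := exists_unique_fixedPoint_affine (M := M) (c := c) hM
  refine ⟨xs, hxs, ?_⟩
  rw [tendsto_iff_norm_sub_tendsto_zero]
  have hlim : Tendsto (fun k => ‖M‖ ^ k * ‖resid (affineMap M c) (x 0)‖ / (1 - ‖M‖)) atTop
      (𝓝 (0 * ‖resid (affineMap M c) (x 0)‖ / (1 - ‖M‖))) :=
    ((tendsto_pow_atTop_nhds_zero_of_lt_one (norm_nonneg _) hM).mul_const _).div_const _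
  rw [zero_mul, zero_div] at hlim
  exact squeeze_zero (fun _ => norm_nonneg _) (norm_sub_fixedPoint_le_pow hx hxs hM) hlim

end Affine

/-! ## §3 The safeguarded scheme and its global convergence [ZOB20, §3.3 Algorithm 3, §4, Thm 6] -/

section Safeguard

variable {E : Type*} [NormedAddCommGroup E] [NormedSpace ℝ E]

open Classical in
/-- `n_AA` at the start of iteration `k`: the number of ACCEPTED Anderson steps among iterations
`0, …, k − 1` (`S` = the set `K_AA` of iterations at which the safeguard test of line 12 passed).
[cite: ZhangOdonoghueBoyd2020, §3.3 Algorithm 3 (n_AA), §4 (K_AA = {k_0, k_1, …})] -/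
noncomputable def aaCount (S : ℕ → Prop) : ℕ → ℕ
  | 0 => 0
  | k + 1 => aaCount S k + if S k then 1 else 0

/-- `n_AA = 0` initially. [cite: ZhangOdonoghueBoyd2020, §3.3 Algorithm 3 (Initialize n_AA = 0)] -/
theorem aaCount_zero (S : ℕ → Prop) : aaCount S 0 = 0 := rfl

open Classical in
/-- The counter advances by one exactly at accepted steps.
[cite: ZhangOdonoghueBoyd2020, §3.3 Algorithm 3 (line 13: n_AA = n_AA + 1)] -/
theorem aaCount_succ (S : ℕ → Prop) (k : ℕ) :
    aaCount S (k + 1) = aaCount S k + if S k then 1 else 0 := rfl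

/-- `n_AA` increments at an accepted step. [cite: ZhangOdonoghueBoyd2020, §3.3 Algorithm 3 (line 13)] -/
theorem aaCount_succ_of_mem {S : ℕ → Prop} {k : ℕ} (hk : S k) :
    aaCount S (k + 1) = aaCount S k + 1 := by
  rw [aaCount_succ, if_pos hk]

/-- `n_AA` is unchanged at a KM step. [cite: ZhangOdonoghueBoyd2020, §3.3 Algorithm 3 (line 14)] -/
theorem aaCount_succ_of_not_mem {S : ℕ → Prop} {k : ℕ} (hk : ¬ S k) :
    aaCount S (k + 1) = aaCount S k := by
  rw [aaCount_succ, if_neg hk, add_zero]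

/-- **The safeguarded Anderson scheme, abstract form of [ZOB20, Algorithm 3 (AA-I-S-m)]** as used by
the proof of Theorem 6: `S ⊆ ℕ` is the set of accepted AA steps (`K_AA`); at `k ∉ S` the KM step
`x^{k+1} = f_α(x^k) = (1 − α)x^k + αf(x^k)` is taken (line 14); at `k ∈ S` the safeguard test
`‖g_k‖ ≤ b_{n_AA}` passed (line 12, printed envelope `b_i = D Ū (i+1)^{−(1+ε)}`) and the accepted step
`x^{k+1} = x^k − H_k g_k` satisfies `‖x^{k+1} − x^k‖ ≤ C ‖g_k‖` (`‖H_k‖₂ ≤ C`, Corollary 5).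
[cite: ZhangOdonoghueBoyd2020, §3.3 Algorithm 3 (lines 12–14), Cor 5, §4 Step 1] -/
structure IsSafeguardedAA (f : E → E) (α C : ℝ) (b : ℕ → ℝ) (S : ℕ → Prop) (x : ℕ → E) :
    Prop where
  /-- line 14: `x^{k+1} = f_α(x^k)` at the iterations where the test fails -/
  km_step : ∀ k, ¬ S k → x (k + 1) = (1 - α) • x k + α • f (x k)
  /-- line 12: the safeguard test `‖g_k‖ ≤ D Ū (n_AA + 1)^{−(1+ε)} = b_{n_AA}` passed -/
  resid_le : ∀ k, S k → ‖resid f (x k)‖ ≤ b (aaCount S k)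
  /-- line 13 with Corollary 5: `‖x^{k+1} − x^k‖ = ‖H_k g_k‖ ≤ C ‖g_k‖` -/
  step_le : ∀ k, S k → ‖x (k + 1) - x k‖ ≤ C * ‖resid f (x k)‖

/-- The pure KM (averaged) iteration is the safeguarded scheme with no accepted AA step.
[cite: ZhangOdonoghueBoyd2020, §1 (KM iteration), §4 ("the cases when either of them is finite")] -/
theorem isSafeguardedAA_km (f : E → E) (α C : ℝ) (b : ℕ → ℝ) (x : ℕ → E)
    (hx : ∀ k, x (k + 1) = (1 - α) • x k + α • f (x k)) :
    IsSafeguardedAA f α C b (fun _ => False) x :=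
  ⟨fun k _ => hx k, fun _ h => h.elim, fun _ h => h.elim⟩

variable {f : E → E} {α C : ℝ} {b : ℕ → ℝ} {S : ℕ → Prop} {x : ℕ → E}

open Classical in
/-- The residual envelope seen along the iteration: `B_k = b_{n_k}` at accepted steps, `0` at KM steps.
[cite: ZhangOdonoghueBoyd2020, §4 Step 1 (‖g_{k_i}‖ ≤ D Ū (i+1)^{−(1+ε)})] -/
noncomputable def envelope (b : ℕ → ℝ) (S : ℕ → Prop) (k : ℕ) : ℝ :=
  if S k then b (aaCount S k) else 0

/-- At an accepted step the envelope is `b_{n_k}`. [cite: ZhangOdonoghueBoyd2020, §3.3 Algorithm 3 (line 12)] -/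
theorem envelope_of_mem {k : ℕ} (hk : S k) : envelope b S k = b (aaCount S k) := if_pos hk

/-- At a KM step the envelope term is `0` ("defining `ε_{l_i} = 0`").
[cite: ZhangOdonoghueBoyd2020, §4 Step 1 ((16))] -/
theorem envelope_of_not_mem {k : ℕ} (hk : ¬ S k) : envelope b S k = 0 := if_neg hk

/-- The envelope is nonnegative. [cite: ZhangOdonoghueBoyd2020, §4 Step 1 (ε_k ≥ 0)] -/
theorem envelope_nonneg (hb : ∀ i, 0 ≤ b i) (k : ℕ) : 0 ≤ envelope b S k := by
  by_cases hk : S k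
  · rw [envelope_of_mem hk]; exact hb _
  · rw [envelope_of_not_mem hk]

/-- **Re-indexing the accepted steps**: `Σ_{k<K} B_k = Σ_{i < n_K} b_i` — the `i`-th accepted step is
tested against `b_i`, so summing the envelope over iterations is summing `b` over the AA counter
("`Σ_{k} ε_k = Σ_{i} ε_{k_i}`"). [cite: ZhangOdonoghueBoyd2020, §4 Step 1 ((11), (14))] -/
theorem sum_envelope_eq (b : ℕ → ℝ) (S : ℕ → Prop) (K : ℕ) :
    ∑ k ∈ Finset.range K, envelope b S k = ∑ i ∈ Finset.range (aaCount S K), b i := by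
  induction K with
  | zero => simp [aaCount_zero]
  | succ K ih =>
    rw [Finset.sum_range_succ, ih]
    by_cases hK : S K
    · rw [envelope_of_mem hK, aaCount_succ_of_mem hK, Finset.sum_range_succ]
    · rw [envelope_of_not_mem hK, aaCount_succ_of_not_mem hK, add_zero]

/-- The envelope is summable along the iteration whenever `Σ_i b_i < ∞`
("`Σ_{i=0}^∞ (i+1)^{−(1+ε)} < ∞`"). [cite: ZhangOdonoghueBoyd2020, §4 Step 1 (11)] -/
theorem summable_envelope (hb : ∀ i, 0 ≤ b i) (hbs : Summable b) :
    Summable (envelope b S) := by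
  refine summable_of_sum_range_le (c := ∑' i, b i) (envelope_nonneg hb) fun K => ?_
  rw [sum_envelope_eq]
  exact hbs.sum_le_tsum _ fun i _ => hb i

/-- The envelope tends to zero along the iteration. [cite: ZhangOdonoghueBoyd2020, §4 Step 1 (15)] -/
theorem tendsto_envelope (hb : ∀ i, 0 ≤ b i) (hbs : Summable b) :
    Tendsto (envelope b S) atTop (𝓝 0) :=
  (summable_envelope hb hbs).tendsto_atTop_zero

/-- At an accepted step the residual is under the envelope: `‖g_k‖ ≤ B_k`.
[cite: ZhangOdonoghueBoyd2020, §3.3 Algorithm 3 (line 12)] -/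
theorem norm_resid_le_envelope (hx : IsSafeguardedAA f α C b S x) {k : ℕ} (hk : S k) :
    ‖resid f (x k)‖ ≤ envelope b S k := by
  rw [envelope_of_mem hk]; exact hx.resid_le k hk

/-- The step error `ε_k = C · B_k` (so `ε_k = 0` at KM steps): `‖x^{k+1} − x^k‖ ≤ ε_k` at accepted
steps. [cite: ZhangOdonoghueBoyd2020, §4 Step 1 ((10): ‖H_{k_i} g_{k_i}‖ ≤ C D Ū (i+1)^{−(1+ε)})] -/
theorem norm_step_le (hx : IsSafeguardedAA f α C b S x) (hC : 0 ≤ C) {k : ℕ} (hk : S k) :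
    ‖x (k + 1) - x k‖ ≤ C * envelope b S k :=
  (hx.step_le k hk).trans (mul_le_mul_of_nonneg_left (norm_resid_le_envelope hx hk) hC)

/-- **Step 1, (10)–(11): quasi-Fejér monotonicity.** For `f` quasi-nonexpansive towards a fixed point
`y` and `0 ≤ α ≤ 1`: `‖x^{k+1} − y‖ ≤ ‖x^k − y‖ + ε_k` with `ε_k = C·B_k`.
[cite: ZhangOdonoghueBoyd2020, §4 Step 1 ((10), (11), (16))] -/
theorem norm_succ_sub_le (hx : IsSafeguardedAA f α C b S x) (hC : 0 ≤ C) (hα0 : 0 ≤ α)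
    (hα1 : α ≤ 1) {y : E} (hfy : ∀ z, ‖f z - y‖ ≤ ‖z - y‖) (k : ℕ) :
    ‖x (k + 1) - y‖ ≤ ‖x k - y‖ + C * envelope b S k := by
  by_cases hk : S k
  · calc ‖x (k + 1) - y‖ = ‖(x (k + 1) - x k) + (x k - y)‖ := by rw [sub_add_sub_cancel]
      _ ≤ ‖x (k + 1) - x k‖ + ‖x k - y‖ := norm_add_le _ _
      _ ≤ C * envelope b S k + ‖x k - y‖ := add_le_add (norm_step_le hx hC hk) le_rfl
      _ = ‖x k - y‖ + C * envelope b S k := add_comm _ _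
  · rw [hx.km_step k hk, envelope_of_not_mem hk, mul_zero, add_zero]
    calc ‖(1 - α) • x k + α • f (x k) - y‖ = ‖(1 - α) • (x k - y) + α • (f (x k) - y)‖ := by
            congr 1; module
      _ ≤ ‖(1 - α) • (x k - y)‖ + ‖α • (f (x k) - y)‖ := norm_add_le _ _
      _ = (1 - α) * ‖x k - y‖ + α * ‖f (x k) - y‖ := by
            rw [norm_smul, norm_smul, Real.norm_of_nonneg (by linarith), Real.norm_of_nonneg hα0]
      _ ≤ (1 - α) * ‖x k - y‖ + α * ‖x k - y‖ :=
            add_le_add le_rfl (mul_le_mul_of_nonneg_left (hfy _) hα0)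
      _ = ‖x k - y‖ := by ring

/-- **Step 1, (11): boundedness.** `‖x^k − y‖ ≤ ‖x^0 − y‖ + C Σ_k B_k =: R` for every `k`.
[cite: ZhangOdonoghueBoyd2020, §4 Step 1 (11)] -/
theorem norm_sub_le_bound (hx : IsSafeguardedAA f α C b S x) (hC : 0 ≤ C) (hα0 : 0 ≤ α)
    (hα1 : α ≤ 1) (hb : ∀ i, 0 ≤ b i) (hbs : Summable b) {y : E}
    (hfy : ∀ z, ‖f z - y‖ ≤ ‖z - y‖) (k : ℕ) :
    ‖x k - y‖ ≤ ‖x 0 - y‖ + ∑' j, C * envelope b S j :=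
  ProximalPointAlgorithm.le_add_tsum_of_le_add (a := fun k => ‖x k - y‖)
    (fun j => mul_nonneg hC (envelope_nonneg hb j)) (norm_succ_sub_le hx hC hα0 hα1 hfy)
    ((summable_envelope hb hbs).mul_left C) k

open Classical in
/-- The KM decrease term `G_k = α(1−α)‖g_k‖²` at KM steps, `0` at accepted steps.
[cite: ZhangOdonoghueBoyd2020, §4 Step 1 (12)] -/
noncomputable def kmDecrease (f : E → E) (α : ℝ) (S : ℕ → Prop) (x : ℕ → E) (k : ℕ) : ℝ :=
  if S k then 0 else α * (1 - α) * ‖resid f (x k)‖ ^ 2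

omit [NormedSpace ℝ E] in
/-- `G_k ≥ 0` for `0 ≤ α ≤ 1`. [cite: ZhangOdonoghueBoyd2020, §4 Step 1 (12)] -/
theorem kmDecrease_nonneg (hα0 : 0 ≤ α) (hα1 : α ≤ 1) (k : ℕ) : 0 ≤ kmDecrease f α S x k := by
  unfold kmDecrease
  split_ifs
  · exact le_rfl
  · exact mul_nonneg (mul_nonneg hα0 (by linarith)) (sq_nonneg _)

end Safeguard

section Hilbert

variable {E : Type*} [NormedAddCommGroup E] [InnerProductSpace ℝ E]
variable {f : E → E} {α C : ℝ} {b : ℕ → ℝ} {S : ℕ → Prop} {x : ℕ → E}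

/-- The KM step of the scheme is the tree's averaged map `averagedMap f α` [Berinde2007, (2)].
[cite: ZhangOdonoghueBoyd2020, §1 (KM iteration)] -/
theorem km_step_eq_averagedMap (hx : IsSafeguardedAA f α C b S x) {k : ℕ} (hk : ¬ S k) :
    x (k + 1) = averagedMap f α (x k) :=
  hx.km_step k hk

/-- **Step 1, (12): the KM inequality** `‖f_α(x) − y‖² ≤ ‖x − y‖² − α(1−α)‖g(x)‖²` for `f`
quasi-nonexpansive towards the fixed point `y`, `0 ≤ α` ([ZOB20] cite Thm 4.25(iii) of
Bauschke–Combettes / (5) of Ryu–Boyd; here from the tree identity `norm_sq_convex_combination`).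
[cite: ZhangOdonoghueBoyd2020, §4 Step 1 (12)] -/
theorem norm_kmStep_sub_sq_le (hα0 : 0 ≤ α) {y z : E} (hfy : ‖f z - y‖ ≤ ‖z - y‖) :
    ‖((1 - α) • z + α • f z) - y‖ ^ 2 ≤ ‖z - y‖ ^ 2 - α * (1 - α) * ‖resid f z‖ ^ 2 := by
  have h1 : ((1 - α) • z + α • f z) - y = (1 - α) • (z - y) + α • (f z - y) := by module
  have h2 : (z - y) - (f z - y) = resid f z := by simp only [resid]; abel
  rw [h1, norm_sq_convex_combination, h2]
  have h3 : ‖f z - y‖ ^ 2 ≤ ‖z - y‖ ^ 2 := pow_le_pow_left₀ (norm_nonneg _) hfy 2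
  nlinarith

/-- **Step 1, (12)–(13) combined**: `‖x^{k+1} − y‖² + G_k ≤ ‖x^k − y‖² + (2R + C Σ B)·ε_k`, where
`R` bounds `‖x^k − y‖` and `G_k = α(1−α)‖g_k‖²` at KM steps.
[cite: ZhangOdonoghueBoyd2020, §4 Step 1 ((12), (13))] -/
theorem norm_succ_sub_sq_le (hx : IsSafeguardedAA f α C b S x) (hC : 0 ≤ C) (hα0 : 0 ≤ α)
    (hα1 : α ≤ 1) (hb : ∀ i, 0 ≤ b i) (hbs : Summable b) {y : E}
    (hfy : ∀ z, ‖f z - y‖ ≤ ‖z - y‖) (k : ℕ) :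
    ‖x (k + 1) - y‖ ^ 2 + kmDecrease f α S x k ≤
      ‖x k - y‖ ^ 2 +
        (2 * (‖x 0 - y‖ + ∑' j, C * envelope b S j) + ∑' j, C * envelope b S j) *
          (C * envelope b S k) := by
  set R : ℝ := ‖x 0 - y‖ + ∑' j, C * envelope b S j with hR
  set T : ℝ := ∑' j, C * envelope b S j with hT
  have he0 : 0 ≤ C * envelope b S k := mul_nonneg hC (envelope_nonneg hb k)
  have hsum : Summable fun j => C * envelope b S j := (summable_envelope hb hbs).mul_left C
  have heT : C * envelope b S k ≤ T :=
    hsum.le_tsum k fun j _ => mul_nonneg hC (envelope_nonneg hb j)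
  have hT0 : 0 ≤ T := he0.trans heT
  have hRk : ‖x k - y‖ ≤ R := norm_sub_le_bound hx hC hα0 hα1 hb hbs hfy k
  by_cases hk : S k
  · -- accepted step: (13)
    have hkm : kmDecrease f α S x k = 0 := if_pos hk
    rw [hkm, add_zero]
    have h1 : ‖x (k + 1) - y‖ ≤ ‖x k - y‖ + C * envelope b S k :=
      norm_succ_sub_le hx hC hα0 hα1 hfy k
    have h2 : ‖x (k + 1) - y‖ ^ 2 ≤ (‖x k - y‖ + C * envelope b S k) ^ 2 :=
      pow_le_pow_left₀ (norm_nonneg _) h1 2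
    nlinarith [norm_nonneg (x k - y), norm_nonneg (x 0 - y)]
  · -- KM step: (12)
    have hkm : kmDecrease f α S x k = α * (1 - α) * ‖resid f (x k)‖ ^ 2 := if_neg hk
    rw [hkm, hx.km_step k hk, envelope_of_not_mem hk, mul_zero, mul_zero, add_zero]
    have := norm_kmStep_sub_sq_le (f := f) hα0 (hfy (x k))
    linarith

/-- **Step 1, (14): the KM decrease terms are summable**:
`α(1−α) Σ_{l_i ∈ K_KM} ‖g_{l_i}‖² ≤ ‖x^0 − y‖² + Σ_k ε'_k < ∞`.
[cite: ZhangOdonoghueBoyd2020, §4 Step 1 (14)] -/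
theorem summable_kmDecrease (hx : IsSafeguardedAA f α C b S x) (hC : 0 ≤ C) (hα0 : 0 ≤ α)
    (hα1 : α ≤ 1) (hb : ∀ i, 0 ≤ b i) (hbs : Summable b) {y : E}
    (hfy : ∀ z, ‖f z - y‖ ≤ ‖z - y‖) : Summable (kmDecrease f α S x) := by
  set L : ℝ := 2 * (‖x 0 - y‖ + ∑' j, C * envelope b S j) + ∑' j, C * envelope b S j
  have hsum : Summable fun j => L * (C * envelope b S j) :=
    ((summable_envelope hb hbs).mul_left C).mul_left L
  have hL : 0 ≤ L := by
    have : 0 ≤ ∑' j, C * envelope b S j :=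
      tsum_nonneg fun j => mul_nonneg hC (envelope_nonneg hb j)
    positivity
  -- telescoping: Σ_{k<K} G_k ≤ ‖x^0 − y‖² − ‖x^K − y‖² + Σ_{k<K} L ε_k
  have htel : ∀ K, ∑ k ∈ Finset.range K, kmDecrease f α S x k ≤
      ‖x 0 - y‖ ^ 2 - ‖x K - y‖ ^ 2 + ∑ k ∈ Finset.range K, L * (C * envelope b S k) := by
    intro K
    induction K with
    | zero => simp
    | succ K ih =>
      rw [Finset.sum_range_succ, Finset.sum_range_succ]
      have := norm_succ_sub_sq_le hx hC hα0 hα1 hb hbs hfy K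
      linarith
  refine summable_of_sum_range_le (c := ‖x 0 - y‖ ^ 2 + ∑' k, L * (C * envelope b S k))
    (kmDecrease_nonneg hα0 hα1) fun K => (htel K).trans ?_
  have h1 : ∑ k ∈ Finset.range K, L * (C * envelope b S k) ≤ ∑' k, L * (C * envelope b S k) :=
    hsum.sum_le_tsum _ fun k _ => mul_nonneg hL (mul_nonneg hC (envelope_nonneg hb k))
  nlinarith [sq_nonneg ‖x K - y‖]

/-- **Step 1, (15): the residuals converge to zero**, `lim_k ‖g_k‖ = 0` — along KM steps by the
summability (14), along accepted steps by the safeguard envelope.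
[cite: ZhangOdonoghueBoyd2020, §4 Step 1 (15)] -/
theorem tendsto_norm_resid (hx : IsSafeguardedAA f α C b S x) (hC : 0 ≤ C) (hα0 : 0 < α)
    (hα1 : α < 1) (hb : ∀ i, 0 ≤ b i) (hbs : Summable b) {y : E}
    (hfy : ∀ z, ‖f z - y‖ ≤ ‖z - y‖) :
    Tendsto (fun k => ‖resid f (x k)‖) atTop (𝓝 0) := by
  have hB := tendsto_envelope (S := S) hb hbs
  have hG := (summable_kmDecrease hx hC hα0.le hα1.le hb hbs hfy).tendsto_atTop_zero
  have hαα : 0 < α * (1 - α) := mul_pos hα0 (by linarith)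
  refine Metric.tendsto_atTop.2 fun η hη => ?_
  have h1 : ∀ᶠ k in atTop, envelope b S k < η := hB.eventually (gt_mem_nhds hη)
  have h2 : ∀ᶠ k in atTop, kmDecrease f α S x k < α * (1 - α) * η ^ 2 :=
    hG.eventually (gt_mem_nhds (by positivity))
  obtain ⟨N, hN⟩ := eventually_atTop.1 (h1.and h2)
  refine ⟨N, fun k hk => ?_⟩
  obtain ⟨hk1, hk2⟩ := hN k hk
  rw [Real.dist_eq, sub_zero, abs_of_nonneg (norm_nonneg _)]
  by_cases hS : S k
  · exact (norm_resid_le_envelope hx hS).trans_lt hk1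
  · have hkm : kmDecrease f α S x k = α * (1 - α) * ‖resid f (x k)‖ ^ 2 := if_neg hS
    rw [hkm] at hk2
    have h3 : ‖resid f (x k)‖ ^ 2 < η ^ 2 := lt_of_mul_lt_mul_left hk2 hαα.le
    exact (pow_lt_pow_iff_left₀ (norm_nonneg _) hη.le two_ne_zero).1 h3

/-- **[ZOB20, THEOREM 6 / COROLLARY 8] — global convergence of the safeguarded Anderson scheme.**
On a proper (e.g. finite-dimensional) real inner product space let `f` be continuous and
quasi-nonexpansive towards its nonempty fixed-point set `X` (`‖f(x) − y‖ ≤ ‖x − y‖` for all `x` and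
all `y ∈ X`; e.g. `f` non-expansive), `0 < α < 1`, `C ≥ 0`, and `(b_i)` a nonnegative summable
safeguard envelope. Then every sequence produced by the safeguarded scheme converges to a fixed point:
`lim_k x^k = x⋆` with `x⋆ = f(x⋆)`. (Steps 2–3 of the printed proof: `‖x^k − y‖` converges for every
`y ∈ X` and the bounded sequence has a cluster point, which is a fixed point because `g(x^k) → 0` and
`g` is continuous.) [cite: ZhangOdonoghueBoyd2020, §4 Thm 6; §6 Cor 8 (quasi-nonexpansive f)] -/
theorem exists_tendsto_of_isSafeguardedAA [ProperSpace E] (hf : Continuous f)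
    (hq : ∀ y ∈ Function.fixedPoints f, ∀ z, ‖f z - y‖ ≤ ‖z - y‖)
    (hne : (Function.fixedPoints f).Nonempty) (hα0 : 0 < α) (hα1 : α < 1) (hC : 0 ≤ C)
    (hb : ∀ i, 0 ≤ b i) (hbs : Summable b) (hx : IsSafeguardedAA f α C b S x) :
    ∃ xs ∈ Function.fixedPoints f, Tendsto x atTop (𝓝 xs) := by
  obtain ⟨y, hy⟩ := hne
  have hres := tendsto_norm_resid hx hC hα0 hα1 hb hbs (hq y hy)
  refine exists_tendsto_of_quasiFejer (F := Function.fixedPoints f)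
    (δ := fun k => C * envelope b S k)
    (fun p hp k => norm_succ_sub_le hx hC hα0.le hα1.le (hq p hp) k)
    (fun k => mul_nonneg hC (envelope_nonneg hb k)) ((summable_envelope hb hbs).mul_left C)
    ⟨y, hy⟩ fun q φ hφ hlim => ?_
  -- Step 3: a cluster point `q` is a fixed point, since `g(x^{φ k}) → g(q)` and `→ 0`
  rw [mem_fixedPoints_iff_resid, ← norm_eq_zero]
  have h1 : Tendsto (fun k => ‖resid f (x (φ k))‖) atTop (𝓝 ‖resid f q‖) :=
    ((continuous_resid hf).norm.tendsto q).comp hlim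
  exact tendsto_nhds_unique h1 (hres.comp hφ.tendsto_atTop)

/-- **[ZOB20, THEOREM 6] with the printed hypothesis**: `f` non-expansive with a fixed point.
[cite: ZhangOdonoghueBoyd2020, §1 (assumptions on f), §4 Thm 6] -/
theorem exists_tendsto_of_isSafeguardedAA_of_nonexpansive [ProperSpace E]
    (hf : ∀ u v, ‖f u - f v‖ ≤ ‖u - v‖) (hne : (Function.fixedPoints f).Nonempty)
    (hα0 : 0 < α) (hα1 : α < 1) (hC : 0 ≤ C) (hb : ∀ i, 0 ≤ b i) (hbs : Summable b)
    (hx : IsSafeguardedAA f α C b S x) :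
    ∃ xs ∈ Function.fixedPoints f, Tendsto x atTop (𝓝 xs) := by
  have hcont : Continuous f :=
    (LipschitzWith.of_dist_le_mul (K := 1) fun u v => by
      simpa [dist_eq_norm] using hf u v).continuous
  refine exists_tendsto_of_isSafeguardedAA hcont (fun y hy z => ?_) hne hα0 hα1 hC hb hbs hx
  have := hf z y
  rwa [show f y = y from hy] at this

/-- The printed envelope `b_i = D Ū (i + 1)^{−(1+ε)}` (`D, Ū ≥ 0`, `ε > 0`) is nonnegative and
summable. [cite: ZhangOdonoghueBoyd2020, §3.3 Algorithm 3 (line 12), §4 (11)] -/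
theorem summable_printedEnvelope {D U ε : ℝ} (hε : 0 < ε) :
    Summable fun i : ℕ => D * U * ((i : ℝ) + 1) ^ (-(1 + ε)) := by
  have h1 : Summable fun n : ℕ => ((n : ℝ) ^ (1 + ε))⁻¹ :=
    Real.summable_nat_rpow_inv.2 (by linarith)
  have h2 : Summable fun i : ℕ => (((i + 1 : ℕ) : ℝ) ^ (1 + ε))⁻¹ :=
    (summable_nat_add_iff 1).2 h1
  refine (h2.mul_left (D * U)).congr fun i => ?_
  rw [Real.rpow_neg (by positivity), Nat.cast_add, Nat.cast_one]

/-- The printed envelope is nonnegative for `D, Ū ≥ 0`.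
[cite: ZhangOdonoghueBoyd2020, §3.3 Algorithm 3 (D > 0, Ū = ‖g_0‖₂)] -/
theorem printedEnvelope_nonneg {D U ε : ℝ} (hD : 0 ≤ D) (hU : 0 ≤ U) (i : ℕ) :
    0 ≤ D * U * ((i : ℝ) + 1) ^ (-(1 + ε)) :=
  mul_nonneg (mul_nonneg hD hU) (Real.rpow_nonneg (by positivity) _)

/-- **[ZOB20, THEOREM 6] verbatim envelope**: the scheme run with the test
`‖g_k‖ ≤ D Ū (n_AA + 1)^{−(1+ε)}` converges to a fixed point of the non-expansive map `f`.
[cite: ZhangOdonoghueBoyd2020, §3.3 Algorithm 3, §4 Thm 6] -/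
theorem exists_tendsto_zob [ProperSpace E] (hf : ∀ u v, ‖f u - f v‖ ≤ ‖u - v‖)
    (hne : (Function.fixedPoints f).Nonempty) (hα0 : 0 < α) (hα1 : α < 1) (hC : 0 ≤ C)
    {D U ε : ℝ} (hD : 0 ≤ D) (hU : 0 ≤ U) (hε : 0 < ε)
    (hx : IsSafeguardedAA f α C (fun i => D * U * ((i : ℝ) + 1) ^ (-(1 + ε))) S x) :
    ∃ xs ∈ Function.fixedPoints f, Tendsto x atTop (𝓝 xs) :=
  exists_tendsto_of_isSafeguardedAA_of_nonexpansive hf hne hα0 hα1 hC (printedEnvelope_nonneg hD hU)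
    (summable_printedEnvelope hε) hx

/-- A GEOMETRIC safeguard envelope `b_i = U·c^i` (`U ≥ 0`, `0 ≤ c < 1`) — what a RELATIVE-DECREASE
acceptance test "accept the `i`-th candidate only if its residual is at most `c` times the residual at
the previously accepted one" produces — is nonnegative and summable, so Theorem 6 applies to it as
well. [cite: ZhangOdonoghueBoyd2020, §4 Step 1 ((11): only Σ_i of the envelope enters)] -/
theorem summable_geometricEnvelope {U c : ℝ} (hc0 : 0 ≤ c) (hc1 : c < 1) :
    Summable fun i : ℕ => U * c ^ i :=
  (summable_geometric_of_lt_one hc0 hc1).mul_left U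

/-- **[ZOB20, THEOREM 6] with a geometric envelope**: the safeguarded scheme whose `i`-th accepted step
passed the test `‖g_k‖ ≤ U·c^i` (`0 ≤ c < 1`) converges to a fixed point of the non-expansive map
`f`. [cite: ZhangOdonoghueBoyd2020, §4 Thm 6] -/
theorem exists_tendsto_zob_geometric [ProperSpace E] (hf : ∀ u v, ‖f u - f v‖ ≤ ‖u - v‖)
    (hne : (Function.fixedPoints f).Nonempty) (hα0 : 0 < α) (hα1 : α < 1) (hC : 0 ≤ C)
    {U c : ℝ} (hU : 0 ≤ U) (hc0 : 0 ≤ c) (hc1 : c < 1)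
    (hx : IsSafeguardedAA f α C (fun i => U * c ^ i) S x) :
    ∃ xs ∈ Function.fixedPoints f, Tendsto x atTop (𝓝 xs) :=
  exists_tendsto_of_isSafeguardedAA_of_nonexpansive hf hne hα0 hα1 hC
    (fun i => mul_nonneg hU (pow_nonneg hc0 i)) (summable_geometricEnvelope hc0 hc1) hx

end Hilbert

/-! ## §4 Contractive maps in an arbitrary norm [ZOB20, §5.1.3 Thm 7; App. proof] -/

section Contractive

variable {E : Type*} [NormedAddCommGroup E] [NormedSpace ℝ E]
variable {f : E → E} {α C γ : ℝ} {b : ℕ → ℝ} {S : ℕ → Prop} {x : ℕ → E}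

omit [NormedSpace ℝ E] in
/-- For a map `γ`-contractive towards its fixed point `y` (`γ < 1`) the distance to `y` is controlled
by the residual: `‖z − y‖ ≤ ‖g(z)‖ / (1 − γ)`. [cite: ZhangOdonoghueBoyd2020, §5.1.3 Thm 7 (proof, App.)] -/
theorem norm_sub_le_resid_div (hγ : γ < 1) {y z : E} (hfy : ‖f z - y‖ ≤ γ * ‖z - y‖) :
    ‖z - y‖ ≤ ‖resid f z‖ / (1 - γ) := by
  rw [le_div_iff₀ (by linarith)]
  have h1 : ‖z - y‖ ≤ ‖resid f z‖ + ‖f z - y‖ := by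
    calc ‖z - y‖ = ‖(z - f z) + (f z - y)‖ := by rw [sub_add_sub_cancel]
      _ ≤ ‖z - f z‖ + ‖f z - y‖ := norm_add_le _ _
      _ = ‖resid f z‖ + ‖f z - y‖ := by rw [resid]
  nlinarith

/-- **One step of the scheme for a contractive map** (`0 < α ≤ 1`, `0 ≤ γ < 1`, `C ≥ 0`): with
`q = 1 − α(1 − γ) < 1` and `K = 1/(1−γ) + C`,
`‖x^{k+1} − y‖ ≤ q‖x^k − y‖ + K·B_k` — at KM steps `‖x^{l_i+1} − y‖ ≤ ((1−α) + αγ)‖x^{l_i} − y‖`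
((18) with `γ` replaced by `(1−α)+αγ`), at accepted steps `‖x^{k_i+1} − y‖ ≤ ‖x^{k_i} − y‖ + C‖g_{k_i}‖`
((17)) and `‖x^{k_i} − y‖ ≤ ‖g_{k_i}‖/(1−γ) ≤ b_i/(1−γ)`.
[cite: ZhangOdonoghueBoyd2020, §5.1.3 Thm 7 (proof (17)–(18), remark on α ∈ (0,1))] -/
theorem norm_succ_sub_le_contractive (hx : IsSafeguardedAA f α C b S x) (hC : 0 ≤ C)
    (hα0 : 0 ≤ α) (hα1 : α ≤ 1) (hγ0 : 0 ≤ γ) (hγ1 : γ < 1) {y : E}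
    (hfy : ∀ z, ‖f z - y‖ ≤ γ * ‖z - y‖) (k : ℕ) :
    ‖x (k + 1) - y‖ ≤ (1 - α * (1 - γ)) * ‖x k - y‖ + (1 / (1 - γ) + C) * envelope b S k := by
  have hq0 : 0 ≤ 1 - α * (1 - γ) := by nlinarith
  have hK0 : 0 ≤ 1 / (1 - γ) + C := add_nonneg (div_nonneg zero_le_one (by linarith)) hC
  by_cases hk : S k
  · -- accepted step
    have h1 : ‖x (k + 1) - y‖ ≤ ‖x k - y‖ + C * envelope b S k := by
      calc ‖x (k + 1) - y‖ = ‖(x (k + 1) - x k) + (x k - y)‖ := by rw [sub_add_sub_cancel]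
        _ ≤ ‖x (k + 1) - x k‖ + ‖x k - y‖ := norm_add_le _ _
        _ ≤ C * envelope b S k + ‖x k - y‖ := add_le_add (norm_step_le hx hC hk) le_rfl
        _ = ‖x k - y‖ + C * envelope b S k := add_comm _ _
    have h2 : ‖x k - y‖ ≤ envelope b S k / (1 - γ) :=
      (norm_sub_le_resid_div hγ1 (hfy (x k))).trans
        (div_le_div_of_nonneg_right (norm_resid_le_envelope hx hk) (by linarith))
    have h3 : 0 ≤ (1 - α * (1 - γ)) * ‖x k - y‖ := mul_nonneg hq0 (norm_nonneg _)
    have h4 : envelope b S k / (1 - γ) = 1 / (1 - γ) * envelope b S k := by ring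
    nlinarith
  · -- KM step
    rw [hx.km_step k hk, envelope_of_not_mem hk, mul_zero, add_zero]
    calc ‖(1 - α) • x k + α • f (x k) - y‖ = ‖(1 - α) • (x k - y) + α • (f (x k) - y)‖ := by
            congr 1; module
      _ ≤ ‖(1 - α) • (x k - y)‖ + ‖α • (f (x k) - y)‖ := norm_add_le _ _
      _ = (1 - α) * ‖x k - y‖ + α * ‖f (x k) - y‖ := by
            rw [norm_smul, norm_smul, Real.norm_of_nonneg (by linarith), Real.norm_of_nonneg hα0]
      _ ≤ (1 - α) * ‖x k - y‖ + α * (γ * ‖x k - y‖) :=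
            add_le_add le_rfl (mul_le_mul_of_nonneg_left (hfy _) hα0)
      _ = (1 - α * (1 - γ)) * ‖x k - y‖ := by ring

/-- **[ZOB20, THEOREM 7 / COROLLARY 8 (quasi-contractive case)] — global convergence for contractive
maps in an arbitrary norm.** On any real normed space, if `f` is `γ`-contractive towards a fixed point
`y` (`0 ≤ γ < 1`: `‖f(z) − y‖ ≤ γ‖z − y‖`), `0 < α ≤ 1` (`α = 1` allowed), `C ≥ 0` and the envelope is
nonnegative and summable, then the safeguarded scheme converges to `y`: `lim_k x^k = x⋆ = y`.
[cite: ZhangOdonoghueBoyd2020, §5.1.3 Thm 7; §6 Cor 8 (quasi-γ-contractive, α = 1 allowed)] -/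
theorem tendsto_of_isSafeguardedAA_of_contractive (hx : IsSafeguardedAA f α C b S x) (hC : 0 ≤ C)
    (hα0 : 0 < α) (hα1 : α ≤ 1) (hγ0 : 0 ≤ γ) (hγ1 : γ < 1) (hb : ∀ i, 0 ≤ b i)
    (hbs : Summable b) {y : E} (hfy : ∀ z, ‖f z - y‖ ≤ γ * ‖z - y‖) :
    Tendsto x atTop (𝓝 y) := by
  rw [tendsto_iff_norm_sub_tendsto_zero]
  have hq1 : 1 - α * (1 - γ) < 1 := by nlinarith
  have hq0 : 0 ≤ 1 - α * (1 - γ) := by nlinarith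
  refine IterationStability.tendsto_zero_of_succ_le_mul_add (fun _ => norm_nonneg _) hq0 hq1
    (norm_succ_sub_le_contractive hx hC hα0.le hα1 hγ0 hγ1 hfy) ?_
  have := (tendsto_envelope (S := S) hb hbs).const_mul (1 / (1 - γ) + C)
  rwa [mul_zero] at this

/-- **[ZOB20, THEOREM 7] with the printed hypothesis**: `f` `γ`-contractive (globally, `γ ∈ [0,1)`) in
the given norm on a complete space; then the fixed point `x⋆` exists, is unique, and the safeguarded
scheme converges to it. [cite: ZhangOdonoghueBoyd2020, §5.1.3 Thm 7] -/
theorem exists_tendsto_of_isSafeguardedAA_of_contractive [CompleteSpace E]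
    (hx : IsSafeguardedAA f α C b S x) (hC : 0 ≤ C) (hα0 : 0 < α) (hα1 : α ≤ 1) (hγ0 : 0 ≤ γ)
    (hγ1 : γ < 1) (hb : ∀ i, 0 ≤ b i) (hbs : Summable b)
    (hf : ∀ u v, ‖f u - f v‖ ≤ γ * ‖u - v‖) :
    ∃ xs : E, f xs = xs ∧ Tendsto x atTop (𝓝 xs) := by
  have hK : ContractingWith ⟨γ, hγ0⟩ f := by
    refine ⟨by exact_mod_cast hγ1, LipschitzWith.of_dist_le_mul fun u v => ?_⟩
    rw [dist_eq_norm, dist_eq_norm]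
    exact hf u v
  refine ⟨ContractingWith.fixedPoint f hK, hK.fixedPoint_isFixedPt, ?_⟩
  refine tendsto_of_isSafeguardedAA_of_contractive hx hC hα0 hα1 hγ0 hγ1 hb hbs fun z => ?_
  have := hf z (ContractingWith.fixedPoint f hK)
  rwa [show f (ContractingWith.fixedPoint f hK) = ContractingWith.fixedPoint f hK from
    hK.fixedPoint_isFixedPt] at this

end Contractive

/-! ## §5 The printed application: Douglas–Rachford splitting [ZOB20, §5.1.2] -/

section DouglasRachford

open Literature.Analysis.Convex.MonotoneOperator
open Literature.Analysis.Convex.DouglasRachford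

variable {H : Type*} [NormedAddCommGroup H] [InnerProductSpace ℝ H]
variable {γ : ℝ} {A B : Set (H × H)} {ja jb : H → H} {α C : ℝ} {b : ℕ → ℝ} {S : ℕ → Prop}
  {z : ℕ → H}

/-- **[ZOB20, §5.1.2 with Theorem 6] — safeguarded Anderson acceleration of Douglas–Rachford
splitting.** Let `A`, `B` be monotone operators on a proper real inner product space with everywhere
defined resolvent maps `ja = J_{λA}`, `jb = J_{λB}` (`λ > 0`; this is what maximality provides), and
suppose `0 ∈ (A + B)(x)` has a solution. The DRS map `f = J_{λA}(2J_{λB} − I) + (I − J_{λB})`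
(`drStep ja jb`; "a ½-averaged (and hence non-expansive) operator") has a fixed point, so the
safeguarded scheme (`0 < α < 1`, `C ≥ 0`, nonnegative summable envelope) run on `f` converges:
`z^k → z⋆` with `f z⋆ = z⋆`, and — "whenever `z^k` converges to a fixed-point of (DRS) (not
necessarily following the DRS iteration), `x^k = R_B(z^k)` converges to a solution of [the inclusion]"
— the shadow sequence `J_{λB}(z^k)` converges to the zero `J_{λB}(z⋆)` of `A + B`.
[cite: ZhangOdonoghueBoyd2020, §5.1.2 (Douglas–Rachford splitting) with §4 Thm 6]
[cite: EcksteinBertsekas1992, §4 Cor 4.1 and Thm 5] -/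
theorem exists_tendsto_of_isSafeguardedAA_drStep [ProperSpace H] (hja : IsResolventMap γ A ja)
    (hjb : IsResolventMap γ B jb) (hA : IsMonotone A) (hB : IsMonotone B) (hγ : 0 < γ)
    (hzer : (zer (opSum A B)).Nonempty) (hα0 : 0 < α) (hα1 : α < 1) (hC : 0 ≤ C)
    (hb : ∀ i, 0 ≤ b i) (hbs : Summable b) (hz : IsSafeguardedAA (drStep ja jb) α C b S z) :
    ∃ zs : H, drStep ja jb zs = zs ∧ jb zs ∈ zer (opSum A B) ∧ Tendsto z atTop (𝓝 zs) ∧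
      Tendsto (fun k => jb (z k)) atTop (𝓝 (jb zs)) := by
  obtain ⟨x, hx⟩ := hzer
  obtain ⟨p, hp, -⟩ := exists_drStep_eq_self_of_mem_zer hja hjb hA hB hγ hx
  have hne : (Function.fixedPoints (drStep ja jb)).Nonempty := ⟨p, hp⟩
  obtain ⟨zs, hzs, hlim⟩ := exists_tendsto_of_isSafeguardedAA_of_nonexpansive
    (fun u v => norm_drStep_sub_le hja hjb hA hB hγ v u) hne hα0 hα1 hC hb hbs hz
  have hzs' : drStep ja jb zs = zs := hzs
  exact ⟨zs, hzs', apply_mem_zer_opSum_of_drStep_eq_self hja hjb hA hB hγ hzs', hlim,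
    ((hjb.continuous hB hγ).tendsto zs).comp hlim⟩

end DouglasRachford

end Literature.Analysis.Convex.AndersonAcceleration
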